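import Summits.BirchSwinnertonDyer.BirchSwinnertonDyer.Theorems.AlignedTransportAtTwoOffStratumPartitionTwistFamilyZhaiSplit
import Literature.NumberTheory.EllipticCurves.HeegnerHypothesisKroneckerProofs
import Literature.NumberTheory.QuadraticFields.DiscriminantOfSqrt
import HarnessLib

/-!
# Route `AlignedTransportAtTwo`, crux C2 `MainConjectureOfRankZeroBSDAtTwo` (stmt-22298), line `birth` — THE ZHAI SUB-FAMILY MADE DECIDABLE:
# «`q` inert in the cubic field `F`» from «the `u`-cubic has no root mod `q`», «bad primes split in `ℚ(√M)`» from Kronecker symbols, and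
# EXPLICIT members: `BSD(W, 2)` IN PRINT for every minimal model of `1727a1^{(37)}` and `1727a1^{(93)}`; `r_an = 0 ∧ BSD(W,2)` (cell road) for `1727a1^{(−3)}`

HONEST FRAMING (cell `bsd-f1-sign2`, WIDTH-5 attach seat `bsd-line-att-p4` g23; `--supports stmt-BirchSwinnertonDyer-22298 --as helper`).
THEOREMS ONLY (no `def`, no named fact, no `sorry`). BSD is NOT proved; C1/C2/C3′ are NOT closed; nothing is asserted — every statement is
CONDITIONAL on the displayed PRINT named facts (hypotheses) and the seed's displayed data.

WHY. Sequel of `…TwistFamilyZhai` / `…TwistFamilyZhaiSplit` (same seat, same gen). Zhai's family is cut out by two conditions on `M` that those files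
carry in the PRINTED idiom: every prime `q ∣ M` «inert in `F`» (`Zhai2016.IsInertIn F q`: `q𝓞_F` prime) and every bad prime of the seed «split in
`ℚ(√M)`» (`SatisfiesHeegnerHypothesis N_S K`). This file turns both into DECIDABLE arithmetic, so that members can be EXHIBITED in the kernel:

* §1 **`isInertIn_of_forall_ne_zero`** — for ANY cubic number field `F` containing a root of the `2`-division cubic of `W` (integer `b₂, b₄, b₆`) and
  ANY prime `q`: if the `u`-cubic `u³ + b₂u² + 8b₄u + 16b₆` has NO root in `ℤ/q`, then `q` is inert in `F`. Proof (Dedekind, no Kummer–Dedekind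
  index condition needed): `e₁ = 4θ ∈ 𝓞_F` is a root of the `u`-cubic; a prime `P ∣ q` of residue degree `1` would have `𝓞_F/P = ℤ/q`, so `e₁ ≡ n`
  and `c(n) ≡ 0 (mod q)` — excluded; hence every `P ∣ q` has `f ≥ 2`, the fundamental identity `Σ e f = 3` leaves ONE prime `P₀` with `f = 3`,
  and `N(q𝓞_F) = q³ = N(P₀)` with `q𝓞_F ⊆ P₀` forces `q𝓞_F = P₀`. (For a good odd `q` «no root mod `q`» is `a_q(W)` odd — Zhai's `N_q` odd.)
* §2 **`satisfiesHeegnerHypothesis_of_kronecker`** — `M` square-free, `M ≡ 1 (mod 4)`, `M ≠ 1`: if `(M/p) = 1` at every odd prime `p ∣ N` (and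
  `M ≡ 1 (mod 8)` if `2 ∣ N`), then every prime of `N` splits in every quadratic field containing `√M` (tree: `d_K = M` by
  `QuadraticFields.Quadratic.discr_eq_of_sq_eq_intCast`, then `satisfiesHeegnerHypothesis_iff_kronecker`).
* §3 EXPLICIT MEMBERS for the seed `1727a1` (`u`-cubic `u³ − 3u² − 1216u + 17600`, `N = 11·157`): `37` and `3, 31` are inert (no root mod `q`, `decide`),
  `(37/11) = (37/157) = (93/11) = (93/157) = 1` (`norm_num`): **`bsdp_two_twist_1727a1_37`**, **`bsdp_two_twist_1727a1_93`** — `BSD(W, 2)` for EVERY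
  globally minimal model `W` of `1727a1^{(37)}` (conductor `1727·37²`) and of `1727a1^{(93)}`, modulo PRINT⁵ {Zhai 1.1, Zhai arXiv v2 Thm. 1.2,
  Creutz–Miller 1.1, GZK, modularity} + displayed {`X₀(1727)`-optimality datum with odd Manin constant, `ord₂(L(1727a1,1)/Ω_∞) = 0`} — no Kato,
  no tower certificate, nothing about the member; and on the NON-split side **`analyticRank_eq_zero_twist_1727a1_neg3`** (`r_an = 0` IN PRINT for
  every minimal model of `1727a1^{(−3)}`, conductor `15543`, modulo Zhai 1.1 + the two displayed data) and **`bsdp_two_twist_1727a1_neg3`**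
  (`BSD(W,2)` there by the cell road: PRINT⁹ + `TowerGapAtTwo 1727a1`).

PARTITION CURRENCY (D-0171): unchanged from the two parents; this file only makes the membership tests of T_Z / T_Z^split kernel-decidable and
exhibits the first members. Beyond-print theorem: no. BSD is NOT proved.

References: [Zhai2016] Thm. 1.1 and arXiv v2 Thm. 1.2; [Marcus2018] Ch. 2 Thm. 1, Ch. 3 Thm. 25 (decomposition in quadratic fields), Ch. 3
Thm. 21 (`Σ e f = n`); [NeukirchANT1999] I.8; [CreutzMiller2012] Thm. 1.1; [Miller2011LMS] Def. 1.1; [CremonaAlgorithms1997] Table 1.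
-/

set_option autoImplicit false
set_option linter.dupNamespace false

noncomputable section

open scoped Classical MatrixGroups ModularForm

open CongruenceSubgroup WeierstrassCurve Polynomial NumberField IsDedekindDomain
open Literature.NumberTheory.EllipticCurves Literature.NumberTheory.EllipticCurves.ModularForms
open Literature.NumberTheory.EllipticCurves.Greenberg1999 Literature.NumberTheory.EllipticCurves.GreenbergVatsal2000
open Literature.NumberTheory.EllipticCurves.Rank1Residual Literature.NumberTheory.EllipticCurves.Rank1Residual.Typed
open Literature.NumberTheory.EllipticCurves.CoatesLiTianZhai2015 Literature.NumberTheory.EllipticCurves.Zhai2016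
open Summit.BirchSwinnertonDyer.Rank1Residual Summit.BirchSwinnertonDyer.Rank1Residual.F1Sign2
open Summit.BirchSwinnertonDyer.Rank1Residual.X1.MuLambda Summit.BirchSwinnertonDyer.Rank1Residual.X5
open Summit.BirchSwinnertonDyer.BirchSwinnertonDyer.Theorems.Rank1ResidualX1Defs
open Summit.BirchSwinnertonDyer.BirchSwinnertonDyer.Theses.AlignedTransportAtTwo
open Summit.BirchSwinnertonDyer.BirchSwinnertonDyer.Theorems.AlignedTransportAtTwoTwistFamilySmallSeeds
open Summit.BirchSwinnertonDyer.BirchSwinnertonDyer.Theorems.AlignedTransportAtTwoTwistFamilyZhai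
open Summit.BirchSwinnertonDyer.BirchSwinnertonDyer.Theorems.AlignedTransportAtTwoTwistFamilyZhaiSplit
open Summit.BirchSwinnertonDyer.BirchSwinnertonDyer.Theorems.TowerClass
open Summit.BirchSwinnertonDyer.BirchSwinnertonDyer.Theorems

namespace Summit.BirchSwinnertonDyer.BirchSwinnertonDyer.Theorems.AlignedTransportAtTwoTwistFamilyZhaiExplicit

/-! ## §1 «`q` inert in `F`» from «no root of the `u`-cubic mod `q`» -/

section Inert

/-- **INERTNESS CRITERION (Dedekind).** `F` a cubic number field containing a root `θ` of the `2`-division cubic `4x³ + b₂x² + 2b₄x + b₆` of `W`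
(`IsTwoDivisionField W F`), with `b₂, b₄, b₆ ∈ ℤ`; `q` a prime such that the `u`-cubic `u³ + b₂u² + 8b₄u + 16b₆` has NO root in `ℤ/q`. Then `q` is
inert in `F` (`q𝓞_F` is prime). Proof: `e = 4θ ∈ 𝓞_F` is a root of the `u`-cubic; a prime `P` of `𝓞_F` over `q` with residue degree `1` has
`𝓞_F/P = 𝔽_q`, so `e ≡ n (mod P)` for an integer `n` and `q ∣ c(n)` — excluded; so every `P ∣ q` has `f(P) ≥ 2`, and `Σ_{P ∣ q} e(P)f(P) = 3` leaves a
single `P₀` with `f = 3`; then `N(q𝓞_F) = q³ = N(P₀)` and `q𝓞_F ⊆ P₀` give `q𝓞_F = P₀`. [cite: Marcus2018, Ch. 3 Thm. 21 and Thm. 22]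
[cite: Zhai2016, §1 («inert in the field F»)] -/
theorem isInertIn_of_forall_ne_zero {F : Type} [Field F] [NumberField F] (W : WeierstrassCurve ℚ) (hF : IsTwoDivisionField W F)
    {b₂ b₄ b₆ : ℤ} (hb₂ : W.b₂ = b₂) (hb₄ : W.b₄ = b₄) (hb₆ : W.b₆ = b₆) {q : ℕ} (hq : q.Prime)
    (hroot : ∀ x : ZMod q, x ^ 3 + (b₂ : ZMod q) * x ^ 2 + 8 * (b₄ : ZMod q) * x + 16 * (b₆ : ZMod q) ≠ 0) :
    IsInertIn F q := by
  classical
  obtain ⟨h3, θ, hθ⟩ := hF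
  -- the printed relation `4θ³ + b₂θ² + 2b₄θ + b₆ = 0`
  have hθ' : 4 * θ ^ 3 + (b₂ : F) * θ ^ 2 + 2 * (b₄ : F) * θ + (b₆ : F) = 0 := by
    have h := hθ
    simp only [WeierstrassCurve.twoTorsionPolynomial, Cubic.toPoly, map_add, map_mul, map_pow, aeval_C, aeval_X,
      hb₂, hb₄, hb₆, eq_ratCast] at h
    push_cast at h
    linear_combination h
  -- `e = 4θ` is a root of the monic integer `u`-cubic, hence an algebraic integer
  have he : (4 * θ) ^ 3 + (b₂ : F) * (4 * θ) ^ 2 + 8 * (b₄ : F) * (4 * θ) + 16 * (b₆ : F) = 0 := by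
    linear_combination (16 : F) * hθ'
  have hmonic : (X ^ 3 + C b₂ * X ^ 2 + C (8 * b₄) * X + C (16 * b₆) : ℤ[X]).Monic := by monicity!
  have hint : _root_.IsIntegral ℤ (4 * θ) := by
    refine ⟨_, hmonic, ?_⟩
    simp only [eval₂_add, eval₂_mul, eval₂_pow, eval₂_X, eval₂_C]
    simp only [eq_intCast, Int.cast_mul, Int.cast_ofNat]
    linear_combination he
  set e : 𝓞 F := ⟨4 * θ, (mem_integralClosure_iff ℤ F).mpr hint⟩ with he_def
  have he' : e ^ 3 + (b₂ : 𝓞 F) * e ^ 2 + 8 * (b₄ : 𝓞 F) * e + 16 * (b₆ : 𝓞 F) = 0 := by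
    apply RingOfIntegers.coe_injective
    simp only [map_add, map_mul, map_pow, map_intCast, map_ofNat, map_zero, he_def, RingOfIntegers.map_mk]
    linear_combination he
  -- the prime `q` of `ℤ`
  set p : Ideal ℤ := Ideal.span {(q : ℤ)} with hp
  haveI : Fact q.Prime := ⟨hq⟩
  have hpb : p ≠ ⊥ := by
    rw [hp, Ne, Ideal.span_singleton_eq_bot]; exact_mod_cast hq.ne_zero
  haveI hpmax : p.IsMaximal :=
    Ideal.IsPrime.isMaximal ((Ideal.span_singleton_prime (by exact_mod_cast hq.ne_zero)).mpr (Nat.prime_iff_prime_int.mp hq)) hpb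
  -- Step A: no prime of `𝓞_F` over `q` has residue degree `1`
  have stepA : ∀ P : Ideal (𝓞 F), P.IsPrime → P.LiesOver p → p.inertiaDeg' P ≠ 1 := by
    intro P hP hPo h1
    haveI := hP
    haveI := hPo
    rw [Ideal.inertiaDeg'_algebraMap] at h1
    haveI : Nontrivial (𝓞 F ⧸ P) := Ideal.Quotient.nontrivial_of_liesOver_of_isPrime P p
    letI : Field (ℤ ⧸ p) := Ideal.Quotient.field p
    obtain ⟨cst, hcst⟩ := (finrank_eq_one_iff_of_nonzero' (1 : 𝓞 F ⧸ P) one_ne_zero).mp h1 (Ideal.Quotient.mk P e)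
    obtain ⟨n, rfl⟩ := Ideal.Quotient.mk_surjective cst
    rw [Algebra.smul_def, mul_one, Ideal.Quotient.algebraMap_mk_of_liesOver, eq_intCast] at hcst
    -- `c(n) ∈ P`, read in `𝓞_F / P`
    have hmem : ((n ^ 3 + b₂ * n ^ 2 + 8 * b₄ * n + 16 * b₆ : ℤ) : 𝓞 F) ∈ P := by
      rw [← Ideal.Quotient.eq_zero_iff_mem]
      have h0 : Ideal.Quotient.mk P (e ^ 3 + (b₂ : 𝓞 F) * e ^ 2 + 8 * (b₄ : 𝓞 F) * e + 16 * (b₆ : 𝓞 F)) = 0 := by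
        rw [he', map_zero]
      rw [← h0]
      push_cast
      simp only [map_add, map_mul, map_pow, hcst]
    have hmemZ : (n ^ 3 + b₂ * n ^ 2 + 8 * b₄ * n + 16 * b₆ : ℤ) ∈ p := by
      rw [Ideal.mem_of_liesOver P p, eq_intCast]
      exact hmem
    rw [hp, Ideal.mem_span_singleton] at hmemZ
    apply hroot (n : ZMod q)
    have hz := (ZMod.intCast_zmod_eq_zero_iff_dvd _ q).mpr hmemZ
    push_cast at hz
    exact hz
  -- Step B: the fundamental identity leaves exactly one prime over `q`, of residue degree `3`
  set T := IsDedekindDomain.primesOverFinset p (𝓞 F) with hT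
  have hsum : ∑ P ∈ T, p.ramificationIdx' P * p.inertiaDeg' P = 3 := by
    rw [← h3]; exact Ideal.sum_ramification_inertia (𝓞 F) ℚ F hpb
  have hterm : ∀ P ∈ T, 2 ≤ p.ramificationIdx' P * p.inertiaDeg' P := by
    intro P hP
    rw [hT, IsDedekindDomain.mem_primesOverFinset_iff hpb] at hP
    obtain ⟨hPp, hPo⟩ := hP
    haveI := hPp
    haveI := hPo
    have hP0 : P ≠ ⊥ := Ideal.ne_bot_of_liesOver_of_ne_bot hpb P
    haveI : P.IsMaximal := hPp.isMaximal hP0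
    have he1 : 1 ≤ p.ramificationIdx' P := by
      rw [Ideal.ramificationIdx'_eq_ramificationIdx _ P hpb]
      exact Nat.one_le_iff_ne_zero.mpr (Ideal.ramificationIdx_pos P ℤ).ne'
    have hf2 : 2 ≤ p.inertiaDeg' P := by
      have h0 := Ideal.inertiaDeg'_pos p P
      have h1 := stepA P hPp hPo
      omega
    nlinarith
  have hcard : T.card ≤ 1 := by
    have h := Finset.card_nsmul_le_sum T _ 2 hterm
    rw [smul_eq_mul, hsum] at h
    omega
  have hne : T.Nonempty := by
    by_contra h
    rw [Finset.not_nonempty_iff_eq_empty] at h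
    rw [h, Finset.sum_empty] at hsum
    exact absurd hsum (by norm_num)
  obtain ⟨P₀, hTP⟩ := Finset.card_eq_one.mp (le_antisymm hcard (Finset.card_pos.mpr hne))
  have hP₀T : P₀ ∈ T := by rw [hTP]; exact Finset.mem_singleton_self _
  rw [hT, IsDedekindDomain.mem_primesOverFinset_iff hpb] at hP₀T
  obtain ⟨hP₀p, hP₀o⟩ := hP₀T
  haveI := hP₀p
  haveI := hP₀o
  have hef : p.ramificationIdx' P₀ * p.inertiaDeg' P₀ = 3 := by
    rw [hTP, Finset.sum_singleton] at hsum; exact hsum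
  have hf3 : p.inertiaDeg' P₀ = 3 := by
    have hdvd : p.inertiaDeg' P₀ ∣ 3 := Dvd.intro_left _ hef
    rcases (Nat.dvd_prime Nat.prime_three).mp hdvd with h | h
    · exact absurd h (stepA P₀ hP₀p hP₀o)
    · exact h
  -- Step C: norms — `N(P₀) = q³ = N(q𝓞_F)` and `q𝓞_F ≤ P₀` force equality
  have hNP : Ideal.absNorm P₀ = q ^ 3 := by
    rw [Ideal.absNorm_eq_pow_inertiaDeg' P₀ hq, hf3]
  have hNI : Ideal.absNorm (Ideal.span {((q : ℤ) : 𝓞 F)}) = q ^ 3 := by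
    rw [Ideal.absNorm_span_singleton, ← map_intCast (algebraMap ℤ (𝓞 F)), Algebra.norm_algebraMap,
      NumberField.RingOfIntegers.rank, h3]
    simp [Int.natAbs_pow]
  have hle : Ideal.span {((q : ℤ) : 𝓞 F)} ≤ P₀ := by
    rw [Ideal.span_le, Set.singleton_subset_iff, SetLike.mem_coe, ← map_intCast (algebraMap ℤ (𝓞 F)),
      ← Ideal.mem_of_liesOver P₀ p]
    rw [hp]; exact Ideal.mem_span_singleton_self _
  obtain ⟨J, hJ⟩ := Ideal.dvd_iff_le.mpr hle
  have hJ1 : Ideal.absNorm J = 1 := by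
    have h := congrArg Ideal.absNorm hJ
    rw [map_mul, hNI, hNP] at h
    have hq3 : (q ^ 3 : ℕ) ≠ 0 := pow_ne_zero _ hq.ne_zero
    have h' : q ^ 3 * Ideal.absNorm J = q ^ 3 * 1 := by rw [mul_one]; exact h.symm
    exact Nat.eq_of_mul_eq_mul_left (Nat.pos_of_ne_zero hq3) h'
  rw [Ideal.absNorm_eq_one_iff] at hJ1
  rw [hJ1, Ideal.mul_top] at hJ
  unfold IsInertIn
  rw [hJ]
  exact hP₀p

end Inert

/-! ## §2 «every bad prime splits in `ℚ(√M)`» from Kronecker symbols -/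

section Split

/-- **SPLITTING CRITERION.** `M` square-free, `M ≡ 1 (mod 4)`, `M ≠ 1` (so `d_K = M` for every quadratic field `K ∋ √M`): if `(M/p) = 1` for every odd
prime `p ∣ N` and `M ≡ 1 (mod 8)` whenever `2 ∣ N`, then every prime of `N` splits in every quadratic field containing `√M`
(`SatisfiesHeegnerHypothesis N K`). Tree: `QuadraticFields.Quadratic.discr_eq_of_sq_eq_intCast` + `satisfiesHeegnerHypothesis_iff_kronecker`.
[cite: Marcus2018, Ch. 2 Thm. 1 and Ch. 3 Thm. 25] -/
theorem satisfiesHeegnerHypothesis_of_kronecker {M : ℤ} (hsq : Squarefree M) (hM4 : M % 4 = 1) (hM1 : M ≠ 1) (N : ℕ)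
    (hkr : ∀ p : ℕ, p.Prime → p ∣ N → (p = 2 → M % 8 = 1) ∧ (p ≠ 2 → jacobiSym M p = 1))
    (K : Type) [Field K] [NumberField K] (h2 : Module.finrank ℚ K = 2) (hx : ∃ x : K, x ^ 2 = (M : K)) :
    SatisfiesHeegnerHypothesis N K := by
  obtain ⟨x, hx⟩ := hx
  have hd : NumberField.discr K = M :=
    Literature.NumberTheory.QuadraticFields.Quadratic.discr_eq_of_sq_eq_intCast h2 hx hM4 hsq hM1
  rw [satisfiesHeegnerHypothesis_iff_kronecker N K h2, hd]
  exact hkr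

end Split

/-! ## §3 Explicit members of the Zhai sub-family of `1727a1` -/

section Seed1727a1

variable (W : WeierstrassCurve ℚ) [W.IsElliptic] [W.IsGloballyMinimal]
  (hmod : nonempty_modularParametrizationData) (hGZK : rank_eq_analyticRank_of_analyticRank_le_one)
  (hCM : bsdTriple_of_rank_le_one_of_conductor_lt)
  (h11 : thm11_ordTwo_LAlg_twist_eq_zero') (h12 : thm12v2_twoPartBSD_twist_of_split)
  (F : Type) [Field F] [NumberField F]

/-- `37` is inert in the cubic field of `1727a1`: `u³ − 3u² − 1216u + 17600` has no root mod `37` (`a₃₇(1727a1)` odd). [cite: CremonaAlgorithms1997, Table 1] -/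
theorem isInertIn_1727a1_37 (hF : IsTwoDivisionField c1727a1 F) : IsInertIn F 37 :=
  isInertIn_of_forall_ne_zero c1727a1 hF c1727a1_b.1 c1727a1_b.2.1 c1727a1_b.2.2 (by norm_num) (by decide)

/-- `3` is inert in the cubic field of `1727a1`: `u³ − 3u² − 1216u + 17600 ≡ u³ + 2u + 2` has no root mod `3`. [cite: CremonaAlgorithms1997, Table 1] -/
theorem isInertIn_1727a1_3 (hF : IsTwoDivisionField c1727a1 F) : IsInertIn F 3 :=
  isInertIn_of_forall_ne_zero c1727a1 hF c1727a1_b.1 c1727a1_b.2.1 c1727a1_b.2.2 Nat.prime_three (by decide)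

/-- `31` is inert in the cubic field of `1727a1` (no root of the `u`-cubic mod `31`). [cite: CremonaAlgorithms1997, Table 1] -/
theorem isInertIn_1727a1_31 (hF : IsTwoDivisionField c1727a1 F) : IsInertIn F 31 :=
  isInertIn_of_forall_ne_zero c1727a1 hF c1727a1_b.1 c1727a1_b.2.1 c1727a1_b.2.2 (by norm_num) (by decide)

/-- `11` and `157` split in every quadratic field containing `√37`: `(37/11) = (37/157) = 1`. [cite: Marcus2018, Ch. 3 Thm. 25] -/
theorem split_1727_37 (K : Type) [Field K] [NumberField K] (h2 : Module.finrank ℚ K = 2) (hx : ∃ x : K, x ^ 2 = ((37 : ℤ) : K)) :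
    SatisfiesHeegnerHypothesis 1727 K := by
  refine satisfiesHeegnerHypothesis_of_kronecker (Int.squarefree_natCast.mpr (by norm_num : Nat.Prime 37).squarefree)
    (by decide) (by decide) 1727 ?_ K h2 hx
  intro p hp hpN
  have h1727 : (1727 : ℕ) = 11 * 157 := by norm_num
  rw [h1727] at hpN
  rcases (Nat.Prime.dvd_mul hp).mp hpN with h | h
  · have hp11 : p = 11 := (Nat.prime_dvd_prime_iff_eq hp (by norm_num)).mp h
    subst hp11
    exact ⟨fun h => absurd h (by norm_num), fun _ => by norm_num⟩
  · have hp157 : p = 157 := (Nat.prime_dvd_prime_iff_eq hp (by norm_num)).mp h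
    subst hp157
    exact ⟨fun h => absurd h (by norm_num), fun _ => by norm_num⟩

/-- `11` and `157` split in every quadratic field containing `√93`: `(93/11) = (93/157) = 1`. [cite: Marcus2018, Ch. 3 Thm. 25] -/
theorem split_1727_93 (K : Type) [Field K] [NumberField K] (h2 : Module.finrank ℚ K = 2) (hx : ∃ x : K, x ^ 2 = ((93 : ℤ) : K)) :
    SatisfiesHeegnerHypothesis 1727 K := by
  have hsq : Squarefree (93 : ℤ) := by
    have : (93 : ℤ) = ((3 * 31 : ℕ) : ℤ) := by norm_num
    rw [this]
    exact Int.squarefree_natCast.mpr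
      ((Nat.squarefree_mul ((Nat.coprime_primes Nat.prime_three (by norm_num)).mpr (by norm_num))).mpr
        ⟨Nat.prime_three.squarefree, (by norm_num : Nat.Prime 31).squarefree⟩)
  refine satisfiesHeegnerHypothesis_of_kronecker hsq (by decide) (by decide) 1727 ?_ K h2 hx
  intro p hp hpN
  have h1727 : (1727 : ℕ) = 11 * 157 := by norm_num
  rw [h1727] at hpN
  rcases (Nat.Prime.dvd_mul hp).mp hpN with h | h
  · have hp11 : p = 11 := (Nat.prime_dvd_prime_iff_eq hp (by norm_num)).mp h
    subst hp11
    exact ⟨fun h => absurd h (by norm_num), fun _ => by norm_num⟩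
  · have hp157 : p = 157 := (Nat.prime_dvd_prime_iff_eq hp (by norm_num)).mp h
    subst hp157
    exact ⟨fun h => absurd h (by norm_num), fun _ => by norm_num⟩

include hmod hGZK hCM h11 h12 in
/-- **`BSD(W, 2)` IN PRINT for EVERY globally minimal model `W` of `1727a1^{(37)}`** (conductor `1727·37² = 2 364 263`; `37` inert in `F`,
`(37/11) = (37/157) = 1` — both kernel-decided), modulo PRINT⁵ {Zhai 2016 Thm. 1.1, Zhai arXiv v2 Thm. 1.2, Creutz–Miller 1.1, GZK, modularity} +
displayed {`Dt` an `X₀(1727)`-optimality datum of `1727a1` with odd Manin constant, `ord₂(L(1727a1,1)/Ω_∞) = 0`, `F` any cubic field of the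
`2`-division polynomial}. No Kato, no tower certificate, nothing about the member. CONDITIONAL; BSD is NOT proved.
[cite: Zhai2016, Thm. 1.1 and arXiv:1409.0231v2 Thm. 1.2] [cite: CreutzMiller2012, Thm. 1.1] [cite: Miller2011LMS, Def. 1.1] -/
theorem bsdp_two_twist_1727a1_37 [NeZero (c1727a1.conductorNorm ℤ)]
    (Dt : ModularParametrizationData c1727a1 (c1727a1.conductorNorm ℤ)) (hopt : Zhai2021.IsOptimalDatum c1727a1 Dt) (hν : ¬ (2 : ℤ) ∣ Dt.c)
    (hL : ∃ x : ℚ, IsLAlg c1727a1 x ∧ x ≠ 0 ∧ padicValRat 2 x = 0) (hF : IsTwoDivisionField c1727a1 F)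
    {c : VariableChange ℚ} (hc : c • c1727a1.quadraticTwist ((37 : ℤ) : ℚ) = W) : BSDp W 2 := by
  have hpf : (37 : ℤ).natAbs.primeFactors = {37} := by
    rw [show (37 : ℤ).natAbs = 37 from rfl]; exact (by norm_num : Nat.Prime 37).primeFactors
  refine bsdp_two_twist_zhaiSplit_1727a1 W hmod hGZK hCM h11 h12 F 37 Dt hopt hν hL hF
    (Int.squarefree_natCast.mpr (by norm_num : Nat.Prime 37).squarefree) (by decide) (by decide) ?_ ?_ (split_1727_37) hc
  · rw [hpf]; exact Finset.singleton_nonempty _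
  · intro q hq
    rw [hpf, Finset.mem_singleton] at hq
    subst hq
    exact ⟨by norm_num, isInertIn_1727a1_37 F hF⟩

include hmod hGZK hCM h11 h12 in
/-- **`BSD(W, 2)` IN PRINT for EVERY globally minimal model `W` of `1727a1^{(93)}`** (`93 = 3·31`, both inert in `F`; `(93/11) = (93/157) = 1`),
modulo PRINT⁵ + the two displayed data of `1727a1`. CONDITIONAL; BSD is NOT proved.
[cite: Zhai2016, Thm. 1.1 and arXiv:1409.0231v2 Thm. 1.2] [cite: CreutzMiller2012, Thm. 1.1] [cite: Miller2011LMS, Def. 1.1] -/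
theorem bsdp_two_twist_1727a1_93 [NeZero (c1727a1.conductorNorm ℤ)]
    (Dt : ModularParametrizationData c1727a1 (c1727a1.conductorNorm ℤ)) (hopt : Zhai2021.IsOptimalDatum c1727a1 Dt) (hν : ¬ (2 : ℤ) ∣ Dt.c)
    (hL : ∃ x : ℚ, IsLAlg c1727a1 x ∧ x ≠ 0 ∧ padicValRat 2 x = 0) (hF : IsTwoDivisionField c1727a1 F)
    {c : VariableChange ℚ} (hc : c • c1727a1.quadraticTwist ((93 : ℤ) : ℚ) = W) : BSDp W 2 := by
  have hsq : Squarefree (93 : ℤ) := by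
    have : (93 : ℤ) = ((3 * 31 : ℕ) : ℤ) := by norm_num
    rw [this]
    exact Int.squarefree_natCast.mpr
      ((Nat.squarefree_mul ((Nat.coprime_primes Nat.prime_three (by norm_num)).mpr (by norm_num))).mpr
        ⟨Nat.prime_three.squarefree, (by norm_num : Nat.Prime 31).squarefree⟩)
  refine bsdp_two_twist_zhaiSplit_1727a1 W hmod hGZK hCM h11 h12 F 93 Dt hopt hν hL hF hsq (by decide) (by decide) ?_ ?_ (split_1727_93) hc
  · exact ⟨3, Nat.mem_primeFactors.mpr ⟨Nat.prime_three, by norm_num, by norm_num⟩⟩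
  · intro q hq
    obtain ⟨hqp, hqd, -⟩ := Nat.mem_primeFactors.mp hq
    rw [show (93 : ℤ).natAbs = 3 * 31 from rfl] at hqd
    rcases (Nat.Prime.dvd_mul hqp).mp hqd with h | h
    · have h3 : q = 3 := (Nat.prime_dvd_prime_iff_eq hqp Nat.prime_three).mp h
      subst h3
      exact ⟨by norm_num, isInertIn_1727a1_3 F hF⟩
    · have h31 : q = 31 := (Nat.prime_dvd_prime_iff_eq hqp (by norm_num)).mp h
      subst h31
      exact ⟨by norm_num, isInertIn_1727a1_31 F hF⟩

include h11 in
/-- **`r_an(W) = 0` IN PRINT for every globally minimal model `W` of `1727a1^{(−3)}`** (conductor `15543 = 1727·3²`; `3` inert in `F`; `11` is INERT in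
`ℚ(√−3)`, so this member is in the Zhai sub-family but NOT in its split part), modulo Zhai 2016 Thm. 1.1 + the two displayed data of `1727a1`.
CONDITIONAL; BSD is NOT proved. [cite: Zhai2016, Thm. 1.1 (arXiv v2 ll. 273–279)] -/
theorem analyticRank_eq_zero_twist_1727a1_neg3 [NeZero (c1727a1.conductorNorm ℤ)]
    (Dt : ModularParametrizationData c1727a1 (c1727a1.conductorNorm ℤ)) (hopt : Zhai2021.IsOptimalDatum c1727a1 Dt) (hν : ¬ (2 : ℤ) ∣ Dt.c)
    (hL : ∃ x : ℚ, IsLAlg c1727a1 x ∧ x ≠ 0 ∧ padicValRat 2 x = 0) (hF : IsTwoDivisionField c1727a1 F)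
    {c : VariableChange ℚ} (hc : c • c1727a1.quadraticTwist ((-3 : ℤ) : ℚ) = W) : W.analyticRank = 0 := by
  have hsq : Squarefree (-3 : ℤ) :=
    Int.squarefree_natAbs.mp (by rw [show (-3 : ℤ).natAbs = 3 from rfl]; exact Nat.prime_three.squarefree)
  have hpf : (-3 : ℤ).natAbs.primeFactors = {3} := by
    rw [show (-3 : ℤ).natAbs = 3 from rfl]; exact Nat.prime_three.primeFactors
  refine analyticRank_eq_zero_twist_of_zhai11' c1727a1 W h11 Dt hopt hν Δ_1727a1_neg' not_hasRationalTwoTorsionX_1727a1 hL F hF (-3) hsq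
    (by decide) (by rw [conductorNorm_1727a1]; decide) ?_ ?_ hc
  · rw [hpf]; exact Finset.singleton_nonempty _
  · intro q hq
    rw [hpf, Finset.mem_singleton] at hq
    subst hq
    exact ⟨by norm_num, isInertIn_1727a1_3 F hF⟩

/-- **`BSD(W, 2)` for every globally minimal model `W` of `1727a1^{(−3)}` by the cell's road** (the non-split side of the Zhai sub-family),
modulo PRINT⁹ {Kato 17.4 (1)(2) at `2`, modularity, Ω⁺/Ω⁻ units, Matsuno 4.2, Greenberg 4.1, GZK, Creutz–Miller 1.1, Zhai 2016 Thm. 1.1} + displayed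
{optimality datum with odd Manin constant, `ord₂(L(1727a1,1)/Ω_∞) = 0`, `TowerGapAtTwo 1727a1`}. CONDITIONAL; BSD is NOT proved.
[cite: Zhai2016, Thm. 1.1] [cite: Kato2004Asterisque, Thm. 17.4 (1)(2) (p. 273)] [cite: CreutzMiller2012, Thm. 1.1] [cite: Miller2011LMS, Def. 1.1] -/
theorem bsdp_two_twist_1727a1_neg3 [NeZero (c1727a1.conductorNorm ℤ)]
    (hKato : ∀ (W : WeierstrassCurve ℚ) [W.IsElliptic] [W.IsGloballyMinimal] ⦃N : ℕ⦄ [NeZero N]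
      (f : CuspForm (Gamma0 N) 2), kato_divisibility_allPrimes W 2 (f := f))
    (hmod : nonempty_modularParametrizationData) (hΩu : realPeriodRat_eq_unit_mul_plusPeriod_two)
    (hΩm : numRealComponents_mul_imaginaryPeriodRat_eq_unit_mul_minusPeriod_two) (hMat : matsuno2008_thm42_transport_two_lines)
    (hGr : Greenberg1999.thm41_charValue_rankZero_anyPrime) (hGZK : rank_eq_analyticRank_of_analyticRank_le_one)
    (hCM : bsdTriple_of_rank_le_one_of_conductor_lt) (h11 : thm11_ordTwo_LAlg_twist_eq_zero')
    (Dt : ModularParametrizationData c1727a1 (c1727a1.conductorNorm ℤ)) (hopt : Zhai2021.IsOptimalDatum c1727a1 Dt) (hν : ¬ (2 : ℤ) ∣ Dt.c)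
    (hL : ∃ x : ℚ, IsLAlg c1727a1 x ∧ x ≠ 0 ∧ padicValRat 2 x = 0) (hgap : O1.TowerGapAtTwo c1727a1) (hF : IsTwoDivisionField c1727a1 F)
    {c : VariableChange ℚ} (hc : c • c1727a1.quadraticTwist ((-3 : ℤ) : ℚ) = W) : BSDp W 2 := by
  have hsq : Squarefree (-3 : ℤ) :=
    Int.squarefree_natAbs.mp (by rw [show (-3 : ℤ).natAbs = 3 from rfl]; exact Nat.prime_three.squarefree)
  have hpf : (-3 : ℤ).natAbs.primeFactors = {3} := by
    rw [show (-3 : ℤ).natAbs = 3 from rfl]; exact Nat.prime_three.primeFactors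
  refine bsdp_two_twist_zhaiFamily_1727a1 W hKato hmod hΩu hΩm hMat hGr hGZK hCM h11 F (-3) Dt hopt hν hL hgap hF hsq (by decide)
    (by decide) ?_ ?_ hc
  · rw [hpf]; exact Finset.singleton_nonempty _
  · intro q hq
    rw [hpf, Finset.mem_singleton] at hq
    subst hq
    exact ⟨by norm_num, isInertIn_1727a1_3 F hF⟩

end Seed1727a1

end Summit.BirchSwinnertonDyer.BirchSwinnertonDyer.Theorems.AlignedTransportAtTwoTwistFamilyZhaiExplicit

end
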